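import Mathlib
import Summits.ValiantsHypothesis.ValiantsHypothesis.Theses.NewtonUnitEquations

/-!
# `DissociatedFixedK` (stmt-ValiantsHypothesis-5907) — the CUBE LEMMA (pure and mixed) and its sharpness

Negative-lane helper for the crux
`Summit.ValiantsHypothesis.ValiantsHypothesis.Theses.NewtonUnitEquations.DissociatedFixedK`
(route NewtonUnitEquations), from the standing disprover's `Cruxes/DissociatedFixedK/Disproof.lean` §A/§A'.
It is the load-bearing algebra of the thickness bound ("the `ℓ`-top survivor differs from the box top of
its alive stratum in `≤ k - 1` coordinates"), in exactly the shape that argument produces, and it is a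
LOWER BOUND statement (at least `card J + 1` live terms are needed), hence lands on the negative lane:

* `cube_lemma_fin`, `cube_lemma` — pure form: `T(ε) = Σ_i x_i Π_j v_ij(ε_j)` equal to `c ≠ 0` at the
  all-`true` corner of `J → Bool` and `0` elsewhere, every live term with all `false`-entries nonzero
  ⇒ `∃ s, (∀ i ∈ s, x i ≠ 0) ∧ card J + 1 ≤ #s`.
* `mixed_cube_lemma` — the same when every live term either has all `false`-entries nonzero or some
  `true`-entry zero (products dead at the survivor).
* `cube_lemma_sharp_one/two` — the bound is attained (`s + 1` terms realise `c·y₁⋯y_s`).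
[folklore]
-/

namespace Summit.ValiantsHypothesis.ValiantsHypothesis.Theorems.DissociatedFixedK.Negative

open Finset

/-! ## §A  The cube lemma (pure and mixed) — CHECKED -/

section CubeLemma
variable {K : Type*} [Field K] {ι : Type*} [Fintype ι] [DecidableEq ι]
/-- **Pure cube lemma** on the cube `Fin n → Bool`.  If `T(ε) = ∑ i, x i * ∏ j, v i j (ε j)` equals
`c ≠ 0` at the all-`true` corner and `0` at every other corner, and every live term (`x i ≠ 0`) has all
its `false`-entries nonzero, then at least `n + 1` terms are live.
(Polynomial reading: `c·y₁⋯yₙ = Σ_i x_i ∏_j (p_ij + q_ij y_j)` with all `p_ij ≠ 0` needs `≥ n+1` terms.)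
Proof: contract coordinate `0` against `(φ, 1)` with `φ = -q/p` of a live term; this kills that term,
keeps the shape, and drops the dimension by one. [folklore] -/
theorem cube_lemma_fin (n : ℕ) :
    ∀ (x : ι → K) (v : ι → Fin n → Bool → K) (c : K), c ≠ 0 →
      (∑ i, x i * ∏ j, v i j true) = c →
      (∀ ε : Fin n → Bool, (∃ j, ε j = false) → (∑ i, x i * ∏ j, v i j (ε j)) = 0) →
      (∀ i, x i ≠ 0 → ∀ j, v i j false ≠ 0) →
      ∃ s : Finset ι, (∀ i ∈ s, x i ≠ 0) ∧ n + 1 ≤ s.card := by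
  induction n with
  | zero =>
    intro x v c hc h1 _ _
    have hex : ∃ i₀, x i₀ * ∏ j, v i₀ j true ≠ 0 := by
      by_contra hne
      simp only [not_exists, not_not] at hne
      exact hc (by rw [← h1]; exact Finset.sum_eq_zero (fun i _ => hne i))
    obtain ⟨i₀, hi₀⟩ := hex
    exact ⟨{i₀}, by simpa using left_ne_zero_of_mul hi₀, by simp⟩
  | succ n ih =>
    intro x v c hc h1 h0 hfull
    -- a live term with all `true`-entries nonzero exists (value `c ≠ 0` at the top corner)
    have hex : ∃ i₀, x i₀ * ∏ j, v i₀ j true ≠ 0 := by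
      by_contra hne
      simp only [not_exists, not_not] at hne
      exact hc (by rw [← h1]; exact Finset.sum_eq_zero (fun i _ => hne i))
    obtain ⟨i₀, hi₀⟩ := hex
    have hx₀ : x i₀ ≠ 0 := left_ne_zero_of_mul hi₀
    have hv₀0 : v i₀ 0 false ≠ 0 := hfull i₀ hx₀ 0
    -- contract coordinate 0 with the covector (φ, 1), φ = - v i₀ 0 true / v i₀ 0 false
    set φ : K := - v i₀ 0 true / v i₀ 0 false with hφ
    set x' : ι → K := fun i => x i * (φ * v i 0 false + v i 0 true) with hx'
    set v' : ι → Fin n → Bool → K := fun i j b => v i j.succ b with hv'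
    have key : ∀ ε : Fin n → Bool,
        (∑ i, x' i * ∏ j, v' i j (ε j)) =
          φ * (∑ i, x i * ∏ j, v i j ((Fin.cons false ε : Fin (n+1) → Bool) j)) +
            (∑ i, x i * ∏ j, v i j ((Fin.cons true ε : Fin (n+1) → Bool) j)) := by
      intro ε
      simp only [hx', hv', Fin.prod_univ_succ, Fin.cons_zero, Fin.cons_succ, Finset.mul_sum,
        ← Finset.sum_add_distrib]
      apply Finset.sum_congr rfl
      intro i _
      ring
    have h1' : (∑ i, x' i * ∏ j, v' i j true) = c := by
      rw [key (fun _ => true)]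
      have hA : (∑ i, x i * ∏ j, v i j ((Fin.cons false (fun _ : Fin n => true) : Fin (n+1) → Bool) j))
          = 0 := h0 _ ⟨0, by simp⟩
      have hB : (∑ i, x i * ∏ j, v i j ((Fin.cons true (fun _ : Fin n => true) : Fin (n+1) → Bool) j))
          = c := by
        have : (Fin.cons true (fun _ : Fin n => true) : Fin (n+1) → Bool) = fun _ => true := by
          funext j
          refine Fin.cases ?_ ?_ j <;> simp
        rw [this]; exact h1
      rw [hA, hB]; ring
    have h0' : ∀ ε : Fin n → Bool, (∃ j, ε j = false) → (∑ i, x' i * ∏ j, v' i j (ε j)) = 0 := by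
      intro ε ⟨j, hj⟩
      rw [key ε]
      have hA : (∑ i, x i * ∏ j, v i j ((Fin.cons false ε : Fin (n+1) → Bool) j)) = 0 :=
        h0 _ ⟨0, by simp⟩
      have hB : (∑ i, x i * ∏ j, v i j ((Fin.cons true ε : Fin (n+1) → Bool) j)) = 0 :=
        h0 _ ⟨j.succ, by simp [hj]⟩
      rw [hA, hB]; ring
    have hfull' : ∀ i, x' i ≠ 0 → ∀ j, v' i j false ≠ 0 := by
      intro i hi j
      exact hfull i (left_ne_zero_of_mul hi) j.succ
    obtain ⟨s', hs'live, hs'card⟩ := ih x' v' c hc h1' h0' hfull'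
    have hdead : x' i₀ = 0 := by
      simp only [hx', hφ]
      field_simp
      ring
    have hi₀s' : i₀ ∉ s' := fun h => hs'live i₀ h hdead
    refine ⟨insert i₀ s', ?_, ?_⟩
    · intro i hi
      rcases Finset.mem_insert.mp hi with rfl | hi
      · exact hx₀
      · exact left_ne_zero_of_mul (hs'live i hi)
    · rw [Finset.card_insert_of_notMem hi₀s']
      omega


/-- **Pure cube lemma** on an arbitrary finite cube `J → Bool` (transport of `cube_lemma_fin` along
`Fintype.equivFin J`). [folklore] -/
theorem cube_lemma {J : Type*} [Fintype J] [DecidableEq J]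
    (x : ι → K) (v : ι → J → Bool → K) (c : K) (hc : c ≠ 0)
    (h1 : (∑ i, x i * ∏ j, v i j true) = c)
    (h0 : ∀ ε : J → Bool, (∃ j, ε j = false) → (∑ i, x i * ∏ j, v i j (ε j)) = 0)
    (hfull : ∀ i, x i ≠ 0 → ∀ j, v i j false ≠ 0) :
    ∃ s : Finset ι, (∀ i ∈ s, x i ≠ 0) ∧ Fintype.card J + 1 ≤ s.card := by
  set e := Fintype.equivFin J with he
  set vF : ι → Fin (Fintype.card J) → Bool → K := fun i j' b => v i (e.symm j') b with hvF
  refine cube_lemma_fin (Fintype.card J) x vF c hc ?_ ?_ ?_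
  · rw [← h1]
    apply Finset.sum_congr rfl
    intro i _
    simp only [hvF]
    rw [e.symm.prod_comp (fun j => v i j true)]
  · intro εF ⟨j', hj'⟩
    have hε : ∃ j, (εF ∘ e) j = false := ⟨e.symm j', by simpa using hj'⟩
    rw [← h0 (εF ∘ e) hε]
    apply Finset.sum_congr rfl
    intro i _
    simp only [hvF]
    rw [← e.symm.prod_comp (fun j => v i j ((εF ∘ e) j))]
    simp
  · intro i hi j'
    exact hfull i hi (e.symm j')

/-- **Mixed cube lemma.**  Same conclusion when every live term EITHER has all `false`-entries nonzero
OR has some `true`-entry equal to zero (a term "dead at the bottom corner").  In the thickness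
argument for `DissociatedFixedK` the first kind are the products alive at the top survivor `a*`
(then also alive at the box-top `b`), the second kind are the products dead at `a*` inside the
re-chosen coordinates; products dead at `a*` outside them have `x i = 0`.
Proof: restrict the cube to `ε_j = true` on a set `U` of chosen dead witnesses (one per dead live
term, so `|U| ≤ #dead`); this kills every dead term and leaves a pure instance on `J \ U`, whence
`#alive ≥ |J| - |U| + 1`. [folklore] -/
theorem mixed_cube_lemma {J : Type*} [Fintype J] [DecidableEq J]
    (x : ι → K) (v : ι → J → Bool → K) (c : K) (hc : c ≠ 0)
    (h1 : (∑ i, x i * ∏ j, v i j true) = c)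
    (h0 : ∀ ε : J → Bool, (∃ j, ε j = false) → (∑ i, x i * ∏ j, v i j (ε j)) = 0)
    (htri : ∀ i, x i ≠ 0 → (∀ j, v i j false ≠ 0) ∨ (∃ j, v i j true = 0)) :
    ∃ s : Finset ι, (∀ i ∈ s, x i ≠ 0) ∧ Fintype.card J + 1 ≤ s.card := by
  classical
  -- dead live terms and one witness coordinate for each
  set D : Finset ι := univ.filter (fun i => x i ≠ 0 ∧ ∃ j, v i j true = 0) with hD
  have hDmem : ∀ i ∈ D, ∃ j, v i j true = 0 := fun i hi => (Finset.mem_filter.mp hi).2.2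
  set U : Finset J := D.attach.image (fun i => (hDmem i.1 i.2).choose) with hU
  have hUspec : ∀ i (hi : i ∈ D), (hDmem i hi).choose ∈ U ∧ v i (hDmem i hi).choose true = 0 :=
    fun i hi => ⟨Finset.mem_image.mpr ⟨⟨i, hi⟩, Finset.mem_attach _ _, rfl⟩, (hDmem i hi).choose_spec⟩
  have hUcard : U.card ≤ D.card := by
    calc U.card ≤ D.attach.card := Finset.card_image_le
      _ = D.card := Finset.card_attach
  -- restricted instance on the sub-cube `Uᶜ`
  set x' : ι → K := fun i => x i * ∏ j ∈ U, v i j true with hx'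
  set v' : ι → ↥(Uᶜ) → Bool → K := fun i j b => v i j.1 b with hv'
  have hdeadkill : ∀ i ∈ D, x' i = 0 := by
    intro i hi
    obtain ⟨hmem, hzero⟩ := hUspec i hi
    simp only [hx']
    rw [Finset.prod_eq_zero hmem hzero, mul_zero]
  -- extension of a corner of the sub-cube by `true` on `U`
  let ext : (↥(Uᶜ) → Bool) → (J → Bool) :=
    fun ε' j => if h : j ∈ U then true else ε' ⟨j, Finset.mem_compl.mpr h⟩
  have hsplit : ∀ (ε' : ↥(Uᶜ) → Bool) (i : ι),
      x' i * ∏ j, v' i j (ε' j) = x i * ∏ j, v i j (ext ε' j) := by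
    intro ε' i
    simp only [hx', hv']
    have hA : ∏ j ∈ U, v i j true = ∏ j ∈ U, v i j (ext ε' j) := by
      apply Finset.prod_congr rfl
      intro j hj
      simp [ext, hj]
    have hB : (∏ j : ↥(Uᶜ), v i j.1 (ε' j)) = ∏ j ∈ Uᶜ, v i j (ext ε' j) := by
      rw [← Finset.prod_coe_sort (Uᶜ) (fun j => v i j (ext ε' j))]
      apply Finset.prod_congr rfl
      intro j _
      have hj : (j : J) ∉ U := Finset.mem_compl.mp j.2
      simp [ext, hj]
    rw [hA, mul_assoc, hB, Finset.prod_mul_prod_compl]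
  have h1' : (∑ i, x' i * ∏ j, v' i j true) = c := by
    rw [← h1]
    apply Finset.sum_congr rfl
    intro i _
    rw [show x' i * ∏ j, v' i j true = x i * ∏ j, v i j (ext (fun _ => true) j) from
      hsplit (fun _ => true) i]
    congr 1
    apply Finset.prod_congr rfl
    intro j _
    simp [ext]
  have h0' : ∀ ε' : ↥(Uᶜ) → Bool, (∃ j, ε' j = false) → (∑ i, x' i * ∏ j, v' i j (ε' j)) = 0 := by
    intro ε' ⟨j, hj⟩
    have hjU : (j : J) ∉ U := Finset.mem_compl.mp j.2
    have hε : ∃ j₀, ext ε' j₀ = false := ⟨j.1, by simp [ext, hjU, hj]⟩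
    rw [← h0 (ext ε') hε]
    apply Finset.sum_congr rfl
    intro i _
    exact hsplit ε' i
  have hfull' : ∀ i, x' i ≠ 0 → ∀ j, v' i j false ≠ 0 := by
    intro i hi j
    have hx : x i ≠ 0 := left_ne_zero_of_mul hi
    rcases htri i hx with h | h
    · exact h j.1
    · exact absurd (hdeadkill i (Finset.mem_filter.mpr ⟨Finset.mem_univ _, hx, h⟩)) hi
  obtain ⟨s, hslive, hscard⟩ := cube_lemma x' v' c hc h1' h0' hfull'
  -- `s` (alive at the restriction) and `D` (dead) are disjoint sets of live terms
  have hdisj : Disjoint s D := by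
    rw [Finset.disjoint_left]
    intro i his hiD
    exact hslive i his (hdeadkill i hiD)
  refine ⟨s ∪ D, ?_, ?_⟩
  · intro i hi
    rcases Finset.mem_union.mp hi with hi | hi
    · exact left_ne_zero_of_mul (hslive i hi)
    · exact (Finset.mem_filter.mp hi).2.1
  · rw [Finset.card_union_of_disjoint hdisj]
    have hcc : Fintype.card ↥(Uᶜ) = Fintype.card J - U.card := by
      rw [Fintype.card_coe, Finset.card_compl]
    have hUle : U.card ≤ Fintype.card J := Finset.card_le_univ U
    omega

end CubeLemma

/-! ## §A'  Sharpness of the cube lemma (thickness `k - 1` is attained) -/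

/-- `s = 1`, two terms: `y = (1 + 2y) - (1 + y)`; in cube form on `Fin 1 → Bool`. [folklore] -/
theorem cube_lemma_sharp_one :
    let x : Fin 2 → ℚ := ![1, -1]
    let v : Fin 2 → Fin 1 → Bool → ℚ := fun i _ b => if b then (![2, 1] i) else 1
    (∑ i, x i * ∏ j, v i j true) = 1 ∧
      (∀ ε : Fin 1 → Bool, (∃ j, ε j = false) → (∑ i, x i * ∏ j, v i j (ε j)) = 0) ∧
      (∀ i, x i ≠ 0 → ∀ j, v i j false ≠ 0) := by
  refine ⟨by norm_num [Fin.sum_univ_two], ?_, ?_⟩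
  · rintro ε ⟨j, hj⟩
    have : ε = fun _ => false := by
      funext j'; rw [Subsingleton.elim j' j]; exact hj
    subst this
    simp [Fin.sum_univ_two]
  · intro i _ j; simp

/-- `s = 2`, three terms (second finite difference): `2·y₁y₂ = Σ_{i=0,1,2} (-1)^i C(2,i) Π_j (1 + i·y_j)`;
in cube form on `Fin 2 → Bool` with `v i j true = i`, `v i j false = 1`, `x = (1,-2,1)`. [folklore] -/
theorem cube_lemma_sharp_two :
    let x : Fin 3 → ℚ := fun i => (-1) ^ (i : ℕ) * (Nat.choose 2 i : ℚ)
    let v : Fin 3 → Fin 2 → Bool → ℚ := fun i _ b => if b then ((i : ℕ) : ℚ) else 1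
    (∑ i, x i * ∏ j, v i j true) = 2 ∧
      (∀ ε : Fin 2 → Bool, (∃ j, ε j = false) → (∑ i, x i * ∏ j, v i j (ε j)) = 0) ∧
      (∀ i, x i ≠ 0 → ∀ j, v i j false ≠ 0) := by
  refine ⟨by norm_num [Fin.sum_univ_three], ?_, ?_⟩
  · rintro ε ⟨j, hj⟩
    -- the three corners with a `false` coordinate
    have hcases : ε = ![false, false] ∨ ε = ![false, true] ∨ ε = ![true, false] := by
      have h0 := ε 0; have h1 := ε 1
      rcases Bool.eq_false_or_eq_true (ε 0) with h0 | h0 <;>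
      rcases Bool.eq_false_or_eq_true (ε 1) with h1 | h1
      · exfalso
        fin_cases j <;> simp_all
      · right; right; funext i; fin_cases i <;> simp [h0, h1]
      · right; left; funext i; fin_cases i <;> simp [h0, h1]
      · left; funext i; fin_cases i <;> simp [h0, h1]
    rcases hcases with rfl | rfl | rfl <;> norm_num [Fin.sum_univ_three, Fin.prod_univ_two]
  · intro i _ j; simp

end Summit.ValiantsHypothesis.ValiantsHypothesis.Theorems.DissociatedFixedK.Negative
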